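import Literature.Probability.LatticeModels.MTP2Tilt
import Literature.Probability.LatticeModels.LikelihoodRatioOrder
import HarnessLib

/-!
# Tilting a tp₂-ordered pair by weights satisfying the cross condition: Karlin–Rinott 1980 Remark 2.1 / Thm. 2.2
# and Holley's hypothesis, density-free on `ℝ^ι`

CITATION HEADER.  Sources.  (1) S. Karlin, Y. Rinott, J. Multivariate Anal. **10** (1980) 467–498
[KarlinRinott1980] (held `paper:doi-10-1016-0047-259x-80-90065-2`), §2 p. 471: "Remark 2.1. If `f₁, f₂, f₃, f₄`
satisfy (2.1) and the same holds for a set of functions `g₁, g₂, g₃, g₄`, then the products `fᵢ gᵢ`, `f₂ g₂`,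
`f₃ g₃`, `f₄ g₄` also satisfy (2.1)", and Thm. 2.2 ((2.8) `f₁(x) f₂(y) ≤ f₂(x ∨ y) f₁(x ∧ y)` ⟹ (2.10)
`∫ φ f₁ dσ ≤ ∫ φ f₂ dσ`); p. 469 (1.18)–(1.19) "(Holley [18], Preston [43], Kemperman [32])".  (2) R. Holley,
Comm. Math. Phys. **36** (1974) 227–231 [Holley1974], Theorem (6): hypothesis (7)
`µ₁(A ∨ B) µ₂(A ∧ B) ≥ µ₁(A) µ₂(B)`.  (3) A. Müller, D. Stoyan (2002) [MullerStoyan2002], Def. 3.11.2 / Thm. 3.11.4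
(the tp₂ order; tree `LikelihoodRatioOrder.lean`).  Printed setting: densities with respect to a σ-finite PRODUCT
measure.  Here the reference pair is an arbitrary tp₂-ordered pair of finite measures on `ℝ^ι` (singular allowed),
`ι` finite: if `µ ≤_tp ν` (set form) and `ρ₁, ρ₂ : ℝ^ι → ℝ≥0` are continuous, bounded and satisfy the CROSS
CONDITION `ρ₁(x) ρ₂(y) ≤ ρ₁(x ∧ y) ρ₂(x ∨ y)` (Holley's (7) for the weights; `ρ₁ = ρ₂` MTP₂ is a special case),
then `ρ₁ • µ ≤_tp ρ₂ • ν`.  The diagonal `µ = ν`, `ρ₁ = ρ₂` is the tree's `mIsSetTP2.withDensity_of_continuous`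
(`MTP2Tilt.lean`), whose printed proof device (cell sums, four functions theorem on the dyadic lattice, dominated
convergence, inner regularity) is run here for a pair.

## What is formalised (no definition, no named fact, no sorry)
* `mTP2Le.tilt_cell_four` — the four-functions hypothesis for the tilted cell weights
  `(ρ₁(q) µ(A ∩ φₙ⁻¹q), ρ₂(q) ν(B ∩ φₙ⁻¹q), ρ₁(q) µ((A∧B) ∩ φₙ⁻¹q), ρ₂(q) ν((A∨B) ∩ φₙ⁻¹q))`;
* `mTP2Le.tilt_level_tp2` — level-`n` inequality `∫_A ρ₁∘φₙ dµ ∫_B ρ₂∘φₙ dν ≤ ∫_{A∧B} ρ₁∘φₙ dµ ∫_{A∨B} ρ₂∘φₙ dν`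
  for compact `A, B` (Mathlib's `four_functions_theorem`);
* `mTP2Le.withDensity_isCompact`, **`mTP2Le.withDensity_of_continuous`** — `µ ≤_tp ν` ⟹ `ρ₁µ ≤_tp ρ₂ν`;
  corollaries `mTP2Le.withDensity_same` (one MTP₂ weight `ρ` on both sides), `mIsSetTP2.withDensity_mTP2Le`
  (one MTP₂ base law `µ`, two cross-ordered weights: **Holley's inequality / Karlin–Rinott Thm. 2.2 with a singular
  MTP₂ reference measure** — then `mTP2Le.integral_le` etc. of `LikelihoodRatioOrder.lean` give `≤_st`),
  `mTP2Le.withDensity_exp_neg` (Gibbs factors `e^{−H₁}`, `e^{−H₂}` with `H₁(x ∧ y) + H₂(x ∨ y) ≤ H₁(x) + H₂(y)`).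
-/

noncomputable section

namespace Literature.Probability.LatticeModels.Affiliation

open MeasureTheory Set Filter Topology Function Metric
open scoped ENNReal NNReal SetFamily

variable {ι : Type*} [Fintype ι]

section Tilt

/-- **The four-functions hypothesis for the tilted cell weights of a pair**: if `µ ≤_tp ν` (set form) and
`ρ₁(x) ρ₂(y) ≤ ρ₁(x ∧ y) ρ₂(x ∨ y)`, then for Borel `A, B` and lattice points `a, b`,
`ρ₁(a)µ(A ∩ φₙ⁻¹a) · ρ₂(b)ν(B ∩ φₙ⁻¹b) ≤ ρ₁(a∧b)µ((A∧B) ∩ φₙ⁻¹(a∧b)) · ρ₂(a∨b)ν((A∨B) ∩ φₙ⁻¹(a∨b))`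
("products of functions satisfying (2.1) satisfy (2.1)"). [cite: KarlinRinott1980, Remark 2.1 with (2.8)] -/
theorem mTP2Le.tilt_cell_four {μ ν : Measure (ι → ℝ)} [IsFiniteMeasure μ] [IsFiniteMeasure ν] (h : mTP2Le μ ν)
    {ρ₁ ρ₂ : (ι → ℝ) → ℝ≥0} (hρ : ∀ x y, ρ₁ x * ρ₂ y ≤ ρ₁ (x ⊓ y) * ρ₂ (x ⊔ y)) (n : ℕ) {A B : Set (ι → ℝ)}
    (hA : MeasurableSet A) (hB : MeasurableSet B) (a b : ι → ℝ) :
    (ρ₁ a : ℝ) * μ.real (A ∩ discretize n ⁻¹' {a}) * ((ρ₂ b : ℝ) * ν.real (B ∩ discretize n ⁻¹' {b})) ≤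
      (ρ₁ (a ⊓ b) : ℝ) * μ.real ((A ⊼ B) ∩ discretize n ⁻¹' {a ⊓ b}) *
        ((ρ₂ (a ⊔ b) : ℝ) * ν.real ((A ⊻ B) ∩ discretize n ⁻¹' {a ⊔ b})) := by
  have h1 : (ρ₁ a : ℝ) * ρ₂ b ≤ ρ₁ (a ⊓ b) * ρ₂ (a ⊔ b) := by exact_mod_cast hρ a b
  have hA' : MeasurableSet (A ∩ discretize n ⁻¹' {a}) :=
    hA.inter (measurable_discretize n (measurableSet_singleton a))
  have hB' : MeasurableSet (B ∩ discretize n ⁻¹' {b}) :=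
    hB.inter (measurable_discretize n (measurableSet_singleton b))
  have hsub1 : (A ∩ discretize n ⁻¹' {a}) ⊼ (B ∩ discretize n ⁻¹' {b}) ⊆
      (A ⊼ B) ∩ discretize n ⁻¹' {a ⊓ b} := by
    rintro _ ⟨x, ⟨hxA, hxa⟩, y, ⟨hyB, hyb⟩, rfl⟩
    refine ⟨⟨x, hxA, y, hyB, rfl⟩, ?_⟩
    rw [mem_preimage, mem_singleton_iff] at hxa hyb ⊢
    rw [discretize_inf, hxa, hyb]
  have hsub2 : (A ∩ discretize n ⁻¹' {a}) ⊻ (B ∩ discretize n ⁻¹' {b}) ⊆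
      (A ⊻ B) ∩ discretize n ⁻¹' {a ⊔ b} := by
    rintro _ ⟨x, ⟨hxA, hxa⟩, y, ⟨hyB, hyb⟩, rfl⟩
    refine ⟨⟨x, hxA, y, hyB, rfl⟩, ?_⟩
    rw [mem_preimage, mem_singleton_iff] at hxa hyb ⊢
    rw [discretize_sup, hxa, hyb]
  have h2 : μ.real (A ∩ discretize n ⁻¹' {a}) * ν.real (B ∩ discretize n ⁻¹' {b}) ≤
      μ.real ((A ⊼ B) ∩ discretize n ⁻¹' {a ⊓ b}) * ν.real ((A ⊻ B) ∩ discretize n ⁻¹' {a ⊔ b}) := by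
    have key := (h hA' hB').trans (mul_le_mul' (measure_mono hsub1) (measure_mono hsub2))
    simp only [measureReal_def, ← ENNReal.toReal_mul]
    exact ENNReal.toReal_mono (ENNReal.mul_ne_top (measure_ne_top _ _) (measure_ne_top _ _)) key
  calc (ρ₁ a : ℝ) * μ.real (A ∩ discretize n ⁻¹' {a}) * ((ρ₂ b : ℝ) * ν.real (B ∩ discretize n ⁻¹' {b}))
      = ((ρ₁ a : ℝ) * ρ₂ b) *
          (μ.real (A ∩ discretize n ⁻¹' {a}) * ν.real (B ∩ discretize n ⁻¹' {b})) := by ring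
    _ ≤ ((ρ₁ (a ⊓ b) : ℝ) * ρ₂ (a ⊔ b)) * (μ.real ((A ⊼ B) ∩ discretize n ⁻¹' {a ⊓ b}) *
          ν.real ((A ⊻ B) ∩ discretize n ⁻¹' {a ⊔ b})) :=
        mul_le_mul h1 h2 (mul_nonneg measureReal_nonneg measureReal_nonneg) (by positivity)
    _ = _ := by ring

open scoped FinsetFamily in
/-- **Level-`n` inequality for the tilted cell sums of a pair** (four functions theorem on the lattice `ℝ^ι`
with `(ρ₁µ-, ρ₂ν-, ρ₁µ-, ρ₂ν-)` cell weights): for compact `A, B`,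
`∫_A ρ₁∘φₙ dµ · ∫_B ρ₂∘φₙ dν ≤ ∫_{A∧B} ρ₁∘φₙ dµ · ∫_{A∨B} ρ₂∘φₙ dν`.
[cite: KarlinRinott1980, Remark 2.1 and Cor. 2.1] [cite: ColangeloMullerScarsini2006, proof of Thm. 1 (b) ⇒ (a) (device)] -/
theorem mTP2Le.tilt_level_tp2 {μ ν : Measure (ι → ℝ)} [IsFiniteMeasure μ] [IsFiniteMeasure ν] (h : mTP2Le μ ν)
    {ρ₁ ρ₂ : (ι → ℝ) → ℝ≥0} (hρ : ∀ x y, ρ₁ x * ρ₂ y ≤ ρ₁ (x ⊓ y) * ρ₂ (x ⊔ y)) {C : ℝ≥0}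
    (hC₁ : ∀ x, ρ₁ x ≤ C) (hC₂ : ∀ x, ρ₂ x ≤ C) (n : ℕ) {A B : Set (ι → ℝ)} (hA : IsCompact A)
    (hB : IsCompact B) :
    (lintegral (μ.restrict A) fun x => (ρ₁ (discretize n x) : ℝ≥0∞)) *
        (lintegral (ν.restrict B) fun x => (ρ₂ (discretize n x) : ℝ≥0∞)) ≤
      (lintegral (μ.restrict (A ⊼ B)) fun x => (ρ₁ (discretize n x) : ℝ≥0∞)) *
        (lintegral (ν.restrict (A ⊻ B)) fun x => (ρ₂ (discretize n x) : ℝ≥0∞)) := by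
  classical
  have hfin : ∀ (τ : Measure (ι → ℝ)) [IsFiniteMeasure τ] {ρ : (ι → ℝ) → ℝ≥0}, (∀ x, ρ x ≤ C) →
      ∀ E : Set (ι → ℝ), (lintegral (τ.restrict E) fun x => (ρ (discretize n x) : ℝ≥0∞)) ≠ ∞ :=
      fun τ _ ρ hC E => by
    refine ne_top_of_le_ne_top
      (ENNReal.mul_ne_top (ENNReal.coe_ne_top (r := C)) (measure_ne_top (τ.restrict E) univ)) ?_
    rw [← lintegral_const]
    exact lintegral_mono fun x => ENNReal.coe_le_coe.2 (hC _)
  set S := (finite_image_discretize n hA.isBounded).toFinset with hSdef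
  set T := (finite_image_discretize n hB.isBounded).toFinset with hTdef
  have hS : discretize n '' A ⊆ ↑S := by rw [hSdef, Finite.coe_toFinset]
  have hT : discretize n '' B ⊆ ↑T := by rw [hTdef, Finite.coe_toFinset]
  have hST : discretize n '' (A ⊼ B) ⊆ ↑(S ⊼ T) := by
    rw [Finset.coe_infs]; exact (image_discretize_infs_subset n A B).trans (Set.infs_subset hS hT)
  have hST' : discretize n '' (A ⊻ B) ⊆ ↑(S ⊻ T) := by
    rw [Finset.coe_sups]; exact (image_discretize_sups_subset n A B).trans (Set.sups_subset hS hT)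
  have hAm := hA.measurableSet
  have hBm := hB.measurableSet
  have hABm := (isCompact_infs hA hB).measurableSet
  have hABm' := (isCompact_sups hA hB).measurableSet
  set f₁ : (ι → ℝ) → ℝ := fun q => (ρ₁ q : ℝ) * μ.real (A ∩ discretize n ⁻¹' {q})
  set f₂ : (ι → ℝ) → ℝ := fun q => (ρ₂ q : ℝ) * ν.real (B ∩ discretize n ⁻¹' {q})
  set f₃ : (ι → ℝ) → ℝ := fun q => (ρ₁ q : ℝ) * μ.real ((A ⊼ B) ∩ discretize n ⁻¹' {q})
  set f₄ : (ι → ℝ) → ℝ := fun q => (ρ₂ q : ℝ) * ν.real ((A ⊻ B) ∩ discretize n ⁻¹' {q})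
  have h0 : ∀ (τ : Measure (ι → ℝ)) (ρ : (ι → ℝ) → ℝ≥0) (E : Set (ι → ℝ)),
      (0 : (ι → ℝ) → ℝ) ≤ fun q => (ρ q : ℝ) * τ.real (E ∩ discretize n ⁻¹' {q}) :=
    fun τ ρ E q => mul_nonneg (NNReal.coe_nonneg _) measureReal_nonneg
  have key : (∑ a ∈ S, f₁ a) * ∑ a ∈ T, f₂ a ≤ (∑ a ∈ S ⊼ T, f₃ a) * ∑ a ∈ S ⊻ T, f₄ a :=
    four_functions_theorem f₁ f₂ f₃ f₄ (h0 μ ρ₁ A) (h0 ν ρ₂ B) (h0 μ ρ₁ (A ⊼ B)) (h0 ν ρ₂ (A ⊻ B))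
      (fun a b => h.tilt_cell_four hρ n hAm hBm a b) S T
  rw [← toReal_setLIntegral_comp_discretize μ ρ₁ n hAm hS, ← toReal_setLIntegral_comp_discretize ν ρ₂ n hBm hT,
    ← toReal_setLIntegral_comp_discretize μ ρ₁ n hABm hST,
    ← toReal_setLIntegral_comp_discretize ν ρ₂ n hABm' hST', ← ENNReal.toReal_mul, ← ENNReal.toReal_mul] at key
  exact (ENNReal.toReal_le_toReal (ENNReal.mul_ne_top (hfin μ hC₁ _) (hfin ν hC₂ _))
    (ENNReal.mul_ne_top (hfin μ hC₁ _) (hfin ν hC₂ _))).1 key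

omit [Fintype ι] in
/-- The tilt of a finite measure by a bounded weight is a finite measure (plumbing). [folklore] -/
private theorem isFiniteMeasure_withDensity_of_le' (μ : Measure (ι → ℝ)) [IsFiniteMeasure μ] {ρ : (ι → ℝ) → ℝ≥0}
    {C : ℝ≥0} (hC : ∀ x, ρ x ≤ C) : IsFiniteMeasure (μ.withDensity fun x => (ρ x : ℝ≥0∞)) := by
  refine isFiniteMeasure_withDensity (ne_top_of_le_ne_top ?_ (lintegral_mono fun x => ENNReal.coe_le_coe.2 (hC x)))
  rw [lintegral_const]
  exact ENNReal.mul_ne_top ENNReal.coe_ne_top (measure_ne_top _ _)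

/-- **Compact sets**: for `µ ≤_tp ν` (finite measures) and continuous bounded weights with the cross condition, the
tilted pair satisfies the tp₂ inequality on every pair of compact sets (level `n`, then dominated convergence).
[cite: KarlinRinott1980, Remark 2.1 and Thm. 2.2] [cite: ColangeloMullerScarsini2006, Thms. 1–2 (device)] -/
theorem mTP2Le.withDensity_isCompact {μ ν : Measure (ι → ℝ)} [IsFiniteMeasure μ] [IsFiniteMeasure ν]
    (h : mTP2Le μ ν) {ρ₁ ρ₂ : (ι → ℝ) → ℝ≥0} (hρ₁c : Continuous ρ₁) (hρ₂c : Continuous ρ₂)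
    (hρ : ∀ x y, ρ₁ x * ρ₂ y ≤ ρ₁ (x ⊓ y) * ρ₂ (x ⊔ y)) {C : ℝ≥0} (hC₁ : ∀ x, ρ₁ x ≤ C) (hC₂ : ∀ x, ρ₂ x ≤ C)
    {A B : Set (ι → ℝ)} (hA : IsCompact A) (hB : IsCompact B) :
    (μ.withDensity fun x => (ρ₁ x : ℝ≥0∞)) A * (ν.withDensity fun x => (ρ₂ x : ℝ≥0∞)) B ≤
      (μ.withDensity fun x => (ρ₁ x : ℝ≥0∞)) (A ⊼ B) * (ν.withDensity fun x => (ρ₂ x : ℝ≥0∞)) (A ⊻ B) := by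
  rw [withDensity_apply _ hA.measurableSet, withDensity_apply _ hB.measurableSet,
    withDensity_apply _ (isCompact_infs hA hB).measurableSet,
    withDensity_apply _ (isCompact_sups hA hB).measurableSet]
  have hne : ∀ (τ : Measure (ι → ℝ)) [IsFiniteMeasure τ] {ρ : (ι → ℝ) → ℝ≥0}, (∀ x, ρ x ≤ C) →
      ∀ E : Set (ι → ℝ), ∫⁻ x in E, (ρ x : ℝ≥0∞) ∂τ ≠ ∞ := fun τ _ ρ hC E => by
    refine ne_top_of_le_ne_top
      (ENNReal.mul_ne_top (ENNReal.coe_ne_top (r := C)) (measure_ne_top (τ.restrict E) univ)) ?_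
    rw [← lintegral_const]
    exact lintegral_mono fun x => ENNReal.coe_le_coe.2 (hC _)
  have hl₁ := tendsto_setLIntegral_comp_discretize μ hρ₁c hC₁
  have hl₂ := tendsto_setLIntegral_comp_discretize ν hρ₂c hC₂
  exact le_of_tendsto_of_tendsto'
    (ENNReal.Tendsto.mul (hl₁ A) (Or.inr (hne ν hC₂ B)) (hl₂ B) (Or.inr (hne μ hC₁ A)))
    (ENNReal.Tendsto.mul (hl₁ (A ⊼ B)) (Or.inr (hne ν hC₂ (A ⊻ B))) (hl₂ (A ⊻ B))
      (Or.inr (hne μ hC₁ (A ⊼ B))))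
    fun n => h.tilt_level_tp2 hρ hC₁ hC₂ n hA hB

/-- **Tilting a tp₂-ordered pair by cross-ordered continuous bounded weights keeps the order** (density-free on
`ℝ^ι`): if `µ ≤_tp ν` are finite measures and `ρ₁, ρ₂ : ℝ^ι → ℝ≥0` are continuous, bounded, with
`ρ₁(x) ρ₂(y) ≤ ρ₁(x ∧ y) ρ₂(x ∨ y)`, then `ρ₁ • µ ≤_tp ρ₂ • ν`.  For densities w.r.t. a product measure this is
Karlin–Rinott's Remark 2.1 with Thm. 2.2 (Holley–Preston); the measure-level statement follows their device
(compact sets above, then inner regularity). [cite: KarlinRinott1980, Remark 2.1, Thm. 2.2, (1.18)–(1.19)]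
[cite: MullerStoyan2002, Def. 3.11.2 / Thm. 3.11.4] -/
theorem mTP2Le.withDensity_of_continuous {μ ν : Measure (ι → ℝ)} [IsFiniteMeasure μ] [IsFiniteMeasure ν]
    (h : mTP2Le μ ν) {ρ₁ ρ₂ : (ι → ℝ) → ℝ≥0} (hρ₁c : Continuous ρ₁) (hρ₂c : Continuous ρ₂)
    (hρ : ∀ x y, ρ₁ x * ρ₂ y ≤ ρ₁ (x ⊓ y) * ρ₂ (x ⊔ y)) {C : ℝ≥0} (hC₁ : ∀ x, ρ₁ x ≤ C)
    (hC₂ : ∀ x, ρ₂ x ≤ C) :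
    mTP2Le (μ.withDensity fun x => (ρ₁ x : ℝ≥0∞)) (ν.withDensity fun x => (ρ₂ x : ℝ≥0∞)) := by
  haveI := isFiniteMeasure_withDensity_of_le' μ hC₁
  haveI := isFiniteMeasure_withDensity_of_le' ν hC₂
  set μ' := μ.withDensity fun x => (ρ₁ x : ℝ≥0∞) with hμ'
  set ν' := ν.withDensity fun x => (ρ₂ x : ℝ≥0∞) with hν'
  intro A B hA hB
  set R := μ' (A ⊼ B) * ν' (A ⊻ B) with hR
  have hK : ∀ K, K ⊆ A → IsCompact K → ∀ K', K' ⊆ B → IsCompact K' → μ' K * ν' K' ≤ R :=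
    fun K hKA hK K' hK'B hK' => (h.withDensity_isCompact hρ₁c hρ₂c hρ hC₁ hC₂ hK hK').trans
      (mul_le_mul' (measure_mono (Set.infs_subset hKA hK'B)) (measure_mono (Set.sups_subset hKA hK'B)))
  rw [hA.measure_eq_iSup_isCompact_of_ne_top (measure_ne_top μ' A),
    hB.measure_eq_iSup_isCompact_of_ne_top (measure_ne_top ν' B)]
  rw [ENNReal.iSup_mul]; refine iSup_le fun K => ?_
  rw [ENNReal.iSup_mul]; refine iSup_le fun hKA => ?_
  rw [ENNReal.iSup_mul]; refine iSup_le fun hKc => ?_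
  rw [ENNReal.mul_iSup]; refine iSup_le fun K' => ?_
  rw [ENNReal.mul_iSup]; refine iSup_le fun hK'B => ?_
  rw [ENNReal.mul_iSup]; exact iSup_le fun hK'c => hK K hKA hKc K' hK'B hK'c

/-- **One MTP₂ weight on both sides**: `µ ≤_tp ν`, `ρ` continuous bounded MTP₂ ⟹ `ρµ ≤_tp ρν` (e.g. a common
Gibbs factor; Shaked–Shanthikumar's closure of `≤_lr` under a common log-supermodular tilt, density case implicit
in Karlin–Rinott Remark 2.1). [cite: KarlinRinott1980, Remark 2.1 and (1.14)] -/
theorem mTP2Le.withDensity_same {μ ν : Measure (ι → ℝ)} [IsFiniteMeasure μ] [IsFiniteMeasure ν] (h : mTP2Le μ ν)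
    {ρ : (ι → ℝ) → ℝ≥0} (hρc : Continuous ρ) (hρ : ∀ x y, ρ x * ρ y ≤ ρ (x ⊓ y) * ρ (x ⊔ y)) {C : ℝ≥0}
    (hC : ∀ x, ρ x ≤ C) :
    mTP2Le (μ.withDensity fun x => (ρ x : ℝ≥0∞)) (ν.withDensity fun x => (ρ x : ℝ≥0∞)) :=
  h.withDensity_of_continuous hρc hρc hρ hC hC

/-- **Holley's inequality with a singular MTP₂ reference measure** (Karlin–Rinott Thm. 2.2 / Holley's Thm. (6)
hypothesis (7), density-free): if `µ` is a finite MTP₂ measure on `ℝ^ι` (Definition 2, no density) and the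
continuous bounded weights satisfy the cross condition `ρ₁(x) ρ₂(y) ≤ ρ₁(x ∧ y) ρ₂(x ∨ y)`, then
`ρ₁ • µ ≤_tp ρ₂ • µ`; with `mTP2Le.integral_le` (equal masses) this is `∫ φ ρ₁ dµ ≤ ∫ φ ρ₂ dµ` for increasing `φ`.
[cite: KarlinRinott1980, Thm. 2.2 with (2.8)] [cite: Holley1974, Theorem (6) (hypothesis (7))] -/
theorem mIsSetTP2.withDensity_mTP2Le {μ : Measure (ι → ℝ)} [IsFiniteMeasure μ] (hμ : mIsSetTP2 μ)
    {ρ₁ ρ₂ : (ι → ℝ) → ℝ≥0} (hρ₁c : Continuous ρ₁) (hρ₂c : Continuous ρ₂)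
    (hρ : ∀ x y, ρ₁ x * ρ₂ y ≤ ρ₁ (x ⊓ y) * ρ₂ (x ⊔ y)) {C : ℝ≥0} (hC₁ : ∀ x, ρ₁ x ≤ C)
    (hC₂ : ∀ x, ρ₂ x ≤ C) :
    mTP2Le (μ.withDensity fun x => (ρ₁ x : ℝ≥0∞)) (μ.withDensity fun x => (ρ₂ x : ℝ≥0∞)) :=
  ((mTP2Le_self_iff μ).2 hμ).withDensity_of_continuous hρ₁c hρ₂c hρ hC₁ hC₂

/-- **Gibbs factors**: `µ ≤_tp ν` finite, `H₁, H₂` continuous, bounded below, with the cross submodularity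
`H₁(x ∧ y) + H₂(x ∨ y) ≤ H₁(x) + H₂(y)` ⟹ `e^{−H₁} µ ≤_tp e^{−H₂} ν` — e.g. two boundary fields `h₁ ≤ h₂`
entering linearly, or a common submodular `H`. [cite: KarlinRinott1980, Remark 2.1, Thm. 2.2 and Thm. 2.3 (density case)]
[cite: Holley1974, Theorem (6) (hypothesis (7))] -/
theorem mTP2Le.withDensity_exp_neg {μ ν : Measure (ι → ℝ)} [IsFiniteMeasure μ] [IsFiniteMeasure ν]
    (h : mTP2Le μ ν) {H₁ H₂ : (ι → ℝ) → ℝ} (hH₁c : Continuous H₁) (hH₂c : Continuous H₂)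
    (hH : ∀ x y, H₁ (x ⊓ y) + H₂ (x ⊔ y) ≤ H₁ x + H₂ y) {m : ℝ} (hm₁ : ∀ x, m ≤ H₁ x) (hm₂ : ∀ x, m ≤ H₂ x) :
    mTP2Le (μ.withDensity fun x => ENNReal.ofReal (Real.exp (-H₁ x)))
      (ν.withDensity fun x => ENNReal.ofReal (Real.exp (-H₂ x))) := by
  have key := h.withDensity_of_continuous (ρ₁ := fun x => (Real.exp (-H₁ x)).toNNReal)
    (ρ₂ := fun x => (Real.exp (-H₂ x)).toNNReal)
    (continuous_real_toNNReal.comp (Real.continuous_exp.comp hH₁c.neg))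
    (continuous_real_toNNReal.comp (Real.continuous_exp.comp hH₂c.neg)) (fun x y => ?_)
    (C := (Real.exp (-m)).toNNReal)
    (fun x => Real.toNNReal_le_toNNReal (Real.exp_le_exp.2 (neg_le_neg (hm₁ x))))
    (fun x => Real.toNNReal_le_toNNReal (Real.exp_le_exp.2 (neg_le_neg (hm₂ x))))
  · exact key
  · rw [← Real.toNNReal_mul (Real.exp_pos _).le, ← Real.toNNReal_mul (Real.exp_pos _).le,
      ← Real.exp_add, ← Real.exp_add]
    exact Real.toNNReal_le_toNNReal (Real.exp_le_exp.2 (by linarith [hH x y]))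

end Tilt

end Literature.Probability.LatticeModels.Affiliation
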